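import Mathlib.Algebra.BigOperators.Ring.Finset
import Mathlib.Algebra.Order.BigOperators.Ring.Finset
import Mathlib.Data.Real.Basic
import Mathlib.Tactic.Linarith
import Mathlib.Tactic.Ring
import Mathlib.Tactic.Positivity

import HarnessLib
import HarnessLib.Audit

/-!
# `NoHeavyLowerTail` (crux stmt-CriticalPhenomena-4575), Sahi programme P4 (Holley / monotone coupling):
# the dimer OR-step `(x ∧ y) ∨ G`, file 1 — the PACKING inequalities for the retained mass below the top fibre

Support file (cell `prim-l12`, seat P4, generation 14; `--supports stmt-CriticalPhenomena-4575`).  No named facts, no sorries;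
standard axioms; def-free.

Context (HOME prim-l12-p4/FROM-prim-l12-p4-gen14-DIMER-REDUCTION.md).  The flow certificate of the slot
`U = {t} × Q ∪ B × G` on `B × Q`, `B = Bool²= {o, a, b, t}` (the dimer `x ∧ y` OR-ed with a certified slot `G ⊆ Q`), is the flat
composite of the certificate `(R', Fl')` of `G`.  Its pair inequality, written in the sections `S_o ⊆ S_a, S_b ⊆ S_t` of the two
up-sets, splits EXACTLY (identity (ID) of the memo) into Harris-type nonnegative terms plus the "packing residual"
`P = q̄ Σ_β ν_β R'(S_β ∩ S'_β ∩ G) − Σ_{β,β'} ν_β ν_β' n(S_β, S'_β')` (`β, β' ∈ {o,a,b}`, `q̄ = ν_o + ν_a + ν_b`).  To bound `P`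
from below by the inner pair inequalities `n(V, W) ≤ R'(V ∩ W ∩ G)` one needs, POINTWISE on `G`, that the retained-mass density
`q̄ Σ_β ν_β 1_{S_β ∩ S'_β}` dominates the demand `Σ_{β,β'} ν_β ν_β' 1_{S_β} 1_{S'_β'}` of the nine section pairs.  This holds
except on the CROSSING CELLS `(S_a ∖ S_b) ∩ (S'_b ∖ S'_a)` and `(S_b ∖ S_a) ∩ (S'_a ∖ S'_b)` of the antichain `{a, b}`; the two
theorems below are the two ways around the obstruction used in the memo:
* `packing_cross`   — add the `R'`-mass of the crossing cells (paid later by the cap `R' ≤ (1+d')ν'` and the top fibre);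
* `packing_diamond` — replace the two cross pairs `(S_a, S'_b), (S_b, S'_a)` by the nested "diamond" pairs
  `(S_a ∩ S_b, S'_a ∪ S'_b), (S_a ∪ S_b, S'_a ∩ S'_b)`, which have the same footprint minus the crossing cells.
Both are pure statements about a nonnegative weight `R` on `G` and nested finite sets; the proofs are the pointwise identity
`q̄ Σ_β ν_β s_β s'_β − Σ_{β,β'} ν_β ν_β' s_β s'_β' = Σ_{β<β'} ν_β ν_β' (s_β' − s_β)(s'_β' − s'_β)` and a sign check per cell.
-/

namespace Summit.CriticalPhenomena.PercolationContinuityZ3.Theorems.SahiE3DimerPacking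

open Finset
open scoped BigOperators

variable {Q : Type*} [DecidableEq Q]

/-- A sum over `X ∩ G` as a sum over `G` of an indicator-weighted function. [folklore] -/
theorem sum_inter_eq_sum_ite (R : Q → ℝ) (X G : Finset Q) :
    ∑ t ∈ X ∩ G, R t = ∑ t ∈ G, (if t ∈ X then R t else 0) := by
  rw [Finset.inter_comm, ← Finset.filter_mem_eq_inter, Finset.sum_filter]

/-- **Packing with crossing cells.**  For nested sections `S_o ⊆ S_a, S_b` and `S'_o ⊆ S'_a, S'_b`, nonnegative weights
`ν_o, ν_a, ν_b` and a weight `R ≥ 0` on `G`: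
`q̄·(ν_o R(S_o∩S'_o∩G) + ν_a R(S_a∩S'_a∩G) + ν_b R(S_b∩S'_b∩G)) + ν_aν_b·R(crossing cells ∩ G) ≥ Σ_{β,β'} ν_βν_β' R(S_β∩S'_β'∩G)`,
`q̄ = ν_o + ν_a + ν_b`. [this work] -/
theorem packing_cross (R : Q → ℝ) (G So Sa Sb To Ta Tb : Finset Q) (hR : ∀ t ∈ G, 0 ≤ R t)
    (hSa : So ⊆ Sa) (hSb : So ⊆ Sb) (hTa : To ⊆ Ta) (hTb : To ⊆ Tb)
    {νo νa νb : ℝ} (hνo : 0 ≤ νo) (hνa : 0 ≤ νa) (hνb : 0 ≤ νb) :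
    νo * νo * ∑ t ∈ (So ∩ To) ∩ G, R t + νo * νa * ∑ t ∈ (So ∩ Ta) ∩ G, R t + νo * νb * ∑ t ∈ (So ∩ Tb) ∩ G, R t
      + νa * νo * ∑ t ∈ (Sa ∩ To) ∩ G, R t + νa * νa * ∑ t ∈ (Sa ∩ Ta) ∩ G, R t + νa * νb * ∑ t ∈ (Sa ∩ Tb) ∩ G, R t
      + νb * νo * ∑ t ∈ (Sb ∩ To) ∩ G, R t + νb * νa * ∑ t ∈ (Sb ∩ Ta) ∩ G, R t + νb * νb * ∑ t ∈ (Sb ∩ Tb) ∩ G, R t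
    ≤ (νo + νa + νb) * (νo * ∑ t ∈ (So ∩ To) ∩ G, R t + νa * ∑ t ∈ (Sa ∩ Ta) ∩ G, R t + νb * ∑ t ∈ (Sb ∩ Tb) ∩ G, R t)
      + νa * νb * (∑ t ∈ ((Sa \ Sb) ∩ (Tb \ Ta)) ∩ G, R t + ∑ t ∈ ((Sb \ Sa) ∩ (Ta \ Tb)) ∩ G, R t) := by
  simp only [sum_inter_eq_sum_ite]
  -- the pointwise surplus
  set g : Q → ℝ := fun t =>
    (νo + νa + νb) * (νo * (if t ∈ So ∩ To then R t else 0) + νa * (if t ∈ Sa ∩ Ta then R t else 0)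
        + νb * (if t ∈ Sb ∩ Tb then R t else 0))
      + νa * νb * ((if t ∈ (Sa \ Sb) ∩ (Tb \ Ta) then R t else 0) + (if t ∈ (Sb \ Sa) ∩ (Ta \ Tb) then R t else 0))
      - (νo * νo * (if t ∈ So ∩ To then R t else 0) + νo * νa * (if t ∈ So ∩ Ta then R t else 0)
        + νo * νb * (if t ∈ So ∩ Tb then R t else 0)
        + νa * νo * (if t ∈ Sa ∩ To then R t else 0) + νa * νa * (if t ∈ Sa ∩ Ta then R t else 0)
        + νa * νb * (if t ∈ Sa ∩ Tb then R t else 0)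
        + νb * νo * (if t ∈ Sb ∩ To then R t else 0) + νb * νa * (if t ∈ Sb ∩ Ta then R t else 0)
        + νb * νb * (if t ∈ Sb ∩ Tb then R t else 0)) with hgdef
  have hg : ∀ t ∈ G, 0 ≤ g t := by
    intro t ht
    have hRt := hR t ht
    have Poo := mul_nonneg (mul_nonneg hνo hνo) hRt
    have Poa := mul_nonneg (mul_nonneg hνo hνa) hRt
    have Pob := mul_nonneg (mul_nonneg hνo hνb) hRt
    have Paa := mul_nonneg (mul_nonneg hνa hνa) hRt
    have Pab := mul_nonneg (mul_nonneg hνa hνb) hRt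
    have Pbb := mul_nonneg (mul_nonneg hνb hνb) hRt
    simp only [hgdef, Finset.mem_inter, Finset.mem_sdiff]
    by_cases hso : t ∈ So <;> by_cases hsa : t ∈ Sa <;> by_cases hsb : t ∈ Sb <;>
      by_cases hto : t ∈ To <;> by_cases hta : t ∈ Ta <;> by_cases htb : t ∈ Tb <;>
      simp only [hso, hsa, hsb, hto, hta, htb, and_true, and_false, and_self,
        not_true_eq_false, not_false_eq_true, ↓reduceIte] <;>
      first
        | exact absurd (hSa hso) hsa
        | exact absurd (hSb hso) hsb
        | exact absurd (hTa hto) hta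
        | exact absurd (hTb hto) htb
        | nlinarith [Poo, Poa, Pob, Paa, Pab, Pbb]
  have hsum : 0 ≤ ∑ t ∈ G, g t := Finset.sum_nonneg hg
  have hexp : ∑ t ∈ G, g t =
      (νo + νa + νb) * (νo * ∑ t ∈ G, (if t ∈ So ∩ To then R t else 0) + νa * ∑ t ∈ G, (if t ∈ Sa ∩ Ta then R t else 0)
          + νb * ∑ t ∈ G, (if t ∈ Sb ∩ Tb then R t else 0))
        + νa * νb * (∑ t ∈ G, (if t ∈ (Sa \ Sb) ∩ (Tb \ Ta) then R t else 0)
          + ∑ t ∈ G, (if t ∈ (Sb \ Sa) ∩ (Ta \ Tb) then R t else 0))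
        - (νo * νo * ∑ t ∈ G, (if t ∈ So ∩ To then R t else 0) + νo * νa * ∑ t ∈ G, (if t ∈ So ∩ Ta then R t else 0)
          + νo * νb * ∑ t ∈ G, (if t ∈ So ∩ Tb then R t else 0)
          + νa * νo * ∑ t ∈ G, (if t ∈ Sa ∩ To then R t else 0) + νa * νa * ∑ t ∈ G, (if t ∈ Sa ∩ Ta then R t else 0)
          + νa * νb * ∑ t ∈ G, (if t ∈ Sa ∩ Tb then R t else 0)
          + νb * νo * ∑ t ∈ G, (if t ∈ Sb ∩ To then R t else 0) + νb * νa * ∑ t ∈ G, (if t ∈ Sb ∩ Ta then R t else 0)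
          + νb * νb * ∑ t ∈ G, (if t ∈ Sb ∩ Tb then R t else 0)) := by
    simp only [hgdef, Finset.sum_add_distrib, Finset.sum_sub_distrib, ← Finset.mul_sum, mul_add]
  linarith [hsum, hexp]

/-- **Packing with the diamond pairs.**  Same setting; the two cross pairs `(S_a, S'_b), (S_b, S'_a)` are replaced by the
nested pairs `(S_a ∩ S_b, S'_a ∪ S'_b)` and `(S_a ∪ S_b, S'_a ∩ S'_b)`, whose joint footprint is that of the cross pairs minus
the crossing cells:
`q̄·(ν_o R(S_o∩S'_o∩G) + ν_a R(S_a∩S'_a∩G) + ν_b R(S_b∩S'_b∩G)) ≥ Σ_{(β,β') ≠ (a,b),(b,a)} ν_βν_β' R(S_β∩S'_β'∩G)`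
`+ ν_aν_b·(R((S_a∩S_b)∩(S'_a∪S'_b)∩G) + R((S_a∪S_b)∩(S'_a∩S'_b)∩G))`. [this work] -/
theorem packing_diamond (R : Q → ℝ) (G So Sa Sb To Ta Tb : Finset Q) (hR : ∀ t ∈ G, 0 ≤ R t)
    (hSa : So ⊆ Sa) (hSb : So ⊆ Sb) (hTa : To ⊆ Ta) (hTb : To ⊆ Tb)
    {νo νa νb : ℝ} (hνo : 0 ≤ νo) (hνa : 0 ≤ νa) (hνb : 0 ≤ νb) :
    νo * νo * ∑ t ∈ (So ∩ To) ∩ G, R t + νo * νa * ∑ t ∈ (So ∩ Ta) ∩ G, R t + νo * νb * ∑ t ∈ (So ∩ Tb) ∩ G, R t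
      + νa * νo * ∑ t ∈ (Sa ∩ To) ∩ G, R t + νa * νa * ∑ t ∈ (Sa ∩ Ta) ∩ G, R t
      + νb * νo * ∑ t ∈ (Sb ∩ To) ∩ G, R t + νb * νb * ∑ t ∈ (Sb ∩ Tb) ∩ G, R t
      + νa * νb * (∑ t ∈ ((Sa ∩ Sb) ∩ (Ta ∪ Tb)) ∩ G, R t + ∑ t ∈ ((Sa ∪ Sb) ∩ (Ta ∩ Tb)) ∩ G, R t)
    ≤ (νo + νa + νb) * (νo * ∑ t ∈ (So ∩ To) ∩ G, R t + νa * ∑ t ∈ (Sa ∩ Ta) ∩ G, R t + νb * ∑ t ∈ (Sb ∩ Tb) ∩ G, R t) := by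
  simp only [sum_inter_eq_sum_ite]
  set g : Q → ℝ := fun t =>
    (νo + νa + νb) * (νo * (if t ∈ So ∩ To then R t else 0) + νa * (if t ∈ Sa ∩ Ta then R t else 0)
        + νb * (if t ∈ Sb ∩ Tb then R t else 0))
      - (νo * νo * (if t ∈ So ∩ To then R t else 0) + νo * νa * (if t ∈ So ∩ Ta then R t else 0)
        + νo * νb * (if t ∈ So ∩ Tb then R t else 0)
        + νa * νo * (if t ∈ Sa ∩ To then R t else 0) + νa * νa * (if t ∈ Sa ∩ Ta then R t else 0)
        + νb * νo * (if t ∈ Sb ∩ To then R t else 0) + νb * νb * (if t ∈ Sb ∩ Tb then R t else 0)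
        + νa * νb * ((if t ∈ (Sa ∩ Sb) ∩ (Ta ∪ Tb) then R t else 0)
          + (if t ∈ (Sa ∪ Sb) ∩ (Ta ∩ Tb) then R t else 0))) with hgdef
  have hg : ∀ t ∈ G, 0 ≤ g t := by
    intro t ht
    have hRt := hR t ht
    have Poo := mul_nonneg (mul_nonneg hνo hνo) hRt
    have Poa := mul_nonneg (mul_nonneg hνo hνa) hRt
    have Pob := mul_nonneg (mul_nonneg hνo hνb) hRt
    have Paa := mul_nonneg (mul_nonneg hνa hνa) hRt
    have Pab := mul_nonneg (mul_nonneg hνa hνb) hRt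
    have Pbb := mul_nonneg (mul_nonneg hνb hνb) hRt
    simp only [hgdef, Finset.mem_inter, Finset.mem_union]
    by_cases hso : t ∈ So <;> by_cases hsa : t ∈ Sa <;> by_cases hsb : t ∈ Sb <;>
      by_cases hto : t ∈ To <;> by_cases hta : t ∈ Ta <;> by_cases htb : t ∈ Tb <;>
      simp only [hso, hsa, hsb, hto, hta, htb, and_true, and_false, and_self, or_true,
        or_false, or_self, ↓reduceIte] <;>
      first
        | exact absurd (hSa hso) hsa
        | exact absurd (hSb hso) hsb
        | exact absurd (hTa hto) hta
        | exact absurd (hTb hto) htb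
        | nlinarith [Poo, Poa, Pob, Paa, Pab, Pbb]
  have hsum : 0 ≤ ∑ t ∈ G, g t := Finset.sum_nonneg hg
  have hexp : ∑ t ∈ G, g t =
      (νo + νa + νb) * (νo * ∑ t ∈ G, (if t ∈ So ∩ To then R t else 0) + νa * ∑ t ∈ G, (if t ∈ Sa ∩ Ta then R t else 0)
          + νb * ∑ t ∈ G, (if t ∈ Sb ∩ Tb then R t else 0))
        - (νo * νo * ∑ t ∈ G, (if t ∈ So ∩ To then R t else 0) + νo * νa * ∑ t ∈ G, (if t ∈ So ∩ Ta then R t else 0)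
          + νo * νb * ∑ t ∈ G, (if t ∈ So ∩ Tb then R t else 0)
          + νa * νo * ∑ t ∈ G, (if t ∈ Sa ∩ To then R t else 0) + νa * νa * ∑ t ∈ G, (if t ∈ Sa ∩ Ta then R t else 0)
          + νb * νo * ∑ t ∈ G, (if t ∈ Sb ∩ To then R t else 0) + νb * νb * ∑ t ∈ G, (if t ∈ Sb ∩ Tb then R t else 0)
          + νa * νb * (∑ t ∈ G, (if t ∈ (Sa ∩ Sb) ∩ (Ta ∪ Tb) then R t else 0)
            + ∑ t ∈ G, (if t ∈ (Sa ∪ Sb) ∩ (Ta ∩ Tb) then R t else 0))) := by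
    simp only [hgdef, Finset.sum_add_distrib, Finset.sum_sub_distrib, ← Finset.mul_sum, mul_add]
  linarith [hsum, hexp]

end Summit.CriticalPhenomena.PercolationContinuityZ3.Theorems.SahiE3DimerPacking
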